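import Literature.NumberTheory.LFunctions.SawtoothPartialSums
import Literature.NumberTheory.Sieve.FejerKernelCounting
import HarnessLib

/-!
# Sums of the sawtooth function over a point set via exponential sums (Heath-Brown 2001, §3,
# proof of Lemma 4: (3.4) and the smoothing of `min{1, (H‖t‖)⁻¹}`)

Ninth proved layer of this seat under the named fact `HeathBrown2001_largestPrimeFactor_cubic`
(`LargestPrimeFactorCubic.lean`; D. R. Heath-Brown, *The largest prime factor of `X³ + 2`*, Proc.
London Math. Soc. (3) 82 (2001) 554–596).  In the proof of Lemma 4 (p. 566) the remainders
`R_J = #𝒜_J − X/N(J) = ψ((X − k)/N(J)) − ψ((2X − k)/N(J))`, `ψ(t) = t − [t] − 1/2`, are summed over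
the family `𝒥` by means of

> (3.4) `ψ(t) = −∑_{n ≤ H} sin(2πnt)/(πn) + O(min{1, (H‖t‖)⁻¹})`,

the first part contributing `≪ ∑_{n ≤ H} n⁻¹ |Σ(n)|`, `Σ(n) = ∑_J e(n t_J)`, and the error term, after
expanding `min{1,(H‖t‖)⁻¹} = ∑ c_n e(nt)`, `c_n ≪ min{log H/H, H/n²}`, contributing
`≪ ∑_n min{log H/H, H/n²} |Σ(n)|` (pp. 566–567), whence (2.9).

This file PROVES a self-contained form of that estimate for an arbitrary finite family of real
points `x_j` (`abs_sum_saw_le`): with `S(d) = ∑_j e(d x_j)`, `V ≥ 1` and `H = 5(2V + 1)`,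

  `|∑_j ψ(x_j)| ≤ (1/π) ∑_{ν=1}^{V} |S(ν)|/ν + (3(2 + log(2V+1))/(2V+1)) ∑_{|d| ≤ H} |S(d)|`

(the `d = 0` term is `#𝒥`; this is (2.9)'s `(log H) H⁻¹ #𝒥 + (log H) ∑ min(n⁻¹, H n⁻²)|Σ(n)|`
quality, with the `n`-range cut at `H` instead of `H²`).  The first term is the tree's truncated
sawtooth series (`AFE.abs_saw_sub_sawPartial_le`: `|ψ − ψ_V| ≤ 1/((2V+1)π‖t‖)`, Titchmarsh
§4.7).  For the error we do NOT expand `min{1,(H‖t‖)⁻¹}` into its Fourier series (not in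
Mathlib); instead the continuous majorant `G(t) = κ/max(‖t‖, κ)`, `κ = 2/(3π(2V+1))`, is compared
with its smoothing by the Fejér kernel `K_H` of the tree (`FejerCounting.fejerKernel`, with
`K_H ≥ 0`, mean `1`, mass `≥ 1/2` on `|t| ≤ 1/(H+1)`): since `G` varies by at most a factor `2` at
scale `1/(H+1) ≤ κ`, `G ≤ 4 (G ∗ K_H)` pointwise (`tentG_le_four_mul_conv`), while
`∑_j (G ∗ K_H)(x_j) = ∫_0^1 G(u) ∑_j K_H(x_j − u) du ≤ (∫_0^1 G) ∑_{|d| ≤ H} |S(d)|` because `K_H`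
is a trigonometric polynomial of degree `H` (`sum_fejerKernel_sub_le`) and
`∫_0^1 G = 2κ(1 + log(1/2κ))` (`integral_tentG_le`).

## References

* D. R. Heath-Brown, *The largest prime factor of `X³ + 2`*, Proc. London Math. Soc. (3) 82 (2001)
  554–596, §3 pp. 566–567, (3.4) and (2.9). [`HeathBrown2001LargestPrimeFactorCubic`]
* E. C. Titchmarsh, *The Theory of the Riemann Zeta-Function*, 2nd ed., §4.7 (the truncated
  sawtooth series). [`Titchmarsh1986`]
* H. L. Montgomery, *Ten lectures on the interface between analytic number theory and harmonic
  analysis*, CBMS 84 (1994), Ch. 1 (Fejér-kernel smoothing). [folklore]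
-/

noncomputable section

open Finset Real MeasureTheory intervalIntegral
open scoped FourierTransform

namespace Literature.NumberTheory.Sieve.LargestPrimeFactorCubic

open Literature.NumberTheory.Sieve.Vinogradov (distInt distInt_nonneg distInt_le_half distInt_neg
  distInt_add_int distInt_eq_zero_iff distInt_sub_le distInt_eq_norm_coe)
open Literature.NumberTheory.Sieve.FejerCounting (fejerKernel fejerKernel_nonneg fejerKernel_eq_sum
  fejerKernel_periodic continuous_fejerKernel intervalIntegrable_fejerKernel
  le_integral_fejerKernel_near_zero distInt_eq_self)
open Literature.NumberTheory.LFunctions.AFE (saw sawPartial saw_def abs_saw_sub_sawPartial_le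
  abs_saw_sub_sawPartial_le_three_halves)

/-! ### The distance to the nearest integer -/

/-- `‖t‖ = min({t}, 1 − {t})`. [folklore] -/
theorem distInt_eq_min_fract (t : ℝ) : distInt t = min (Int.fract t) (1 - Int.fract t) := by
  rw [distInt, abs_sub_round_eq_min]

/-- `‖1 − u‖ = ‖u‖`. [folklore] -/
theorem distInt_one_sub (u : ℝ) : distInt (1 - u) = distInt u := by
  rw [show (1 : ℝ) - u = -u + (1 : ℤ) by push_cast; ring, distInt_add_int, distInt_neg]

/-! ### The majorant `G(t) = κ / max(‖t‖, κ)` of `min{1, κ/‖t‖}` -/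

/-- `G_κ(t) = κ / max(‖t‖, κ)`: equals `1` for `‖t‖ ≤ κ` and `κ/‖t‖` beyond; continuous and
`1`-periodic. [cite: HeathBrown2001LargestPrimeFactorCubic, §3 (3.4)] -/
def tentG (κ t : ℝ) : ℝ := κ / max (distInt t) κ

variable {κ : ℝ}

/-- Auxiliary fact `tentG_nonneg` for this file's estimates. [folklore] -/
theorem tentG_nonneg (hκ : 0 < κ) (t : ℝ) : 0 ≤ tentG κ t := by
  unfold tentG; exact div_nonneg hκ.le (le_trans hκ.le (le_max_right _ _))

/-- Auxiliary fact `tentG_le_one` for this file's estimates. [folklore] -/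
theorem tentG_le_one (hκ : 0 < κ) (t : ℝ) : tentG κ t ≤ 1 := by
  unfold tentG
  rw [div_le_one (lt_of_lt_of_le hκ (le_max_right _ _))]
  exact le_max_right _ _

/-- Auxiliary fact `tentG_periodic` for this file's estimates. [folklore] -/
theorem tentG_periodic (κ : ℝ) : Function.Periodic (tentG κ) 1 := by
  intro t
  unfold tentG
  rw [show t + 1 = t + (1 : ℤ) by push_cast; ring, distInt_add_int]

/-- Auxiliary fact `continuous_tentG` for this file's estimates. [folklore] -/
theorem continuous_tentG (hκ : 0 < κ) : Continuous (tentG κ) := by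
  -- `‖·‖` is continuous: it is the norm on `ℝ/ℤ` (cf. `MicciancioRegev2007.continuous_distInt`)
  have hdist : Continuous distInt := by
    have : distInt = fun x : ℝ => ‖((x : ℝ) : UnitAddCircle)‖ := funext distInt_eq_norm_coe
    rw [this]
    exact continuous_norm.comp (AddCircle.continuous_mk' 1)
  unfold tentG
  refine continuous_const.div (hdist.max continuous_const) (fun t => ?_)
  exact (lt_of_lt_of_le hκ (le_max_right _ _)).ne'

/-- Auxiliary fact `tentG_one_sub` for this file's estimates. [folklore] -/
theorem tentG_one_sub (κ u : ℝ) : tentG κ (1 - u) = tentG κ u := by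
  unfold tentG; rw [distInt_one_sub]

/-- On `[0, 1/2]`: `G(u) ≤ 1` and `G(u) ≤ κ/u`. [folklore] -/
theorem tentG_le_div (hκ : 0 < κ) {u : ℝ} (h0 : 0 < u) (h2 : u ≤ 1 / 2) : tentG κ u ≤ κ / u := by
  unfold tentG
  rw [distInt_eq_self h0.le h2]
  exact div_le_div_of_nonneg_left hκ.le h0 (le_max_left _ _)

/-- **Slow variation**: `G(t − w) ≥ G(t)/2` for `|w| ≤ κ` (`‖t − w‖ ≤ ‖t‖ + |w|`).
[folklore] -/
theorem tentG_sub_ge (hκ : 0 < κ) (t : ℝ) {w : ℝ} (hw : |w| ≤ κ) : tentG κ t / 2 ≤ tentG κ (t - w) := by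
  unfold tentG
  have h1 : distInt (t - w) ≤ distInt t + κ := by
    have := distInt_sub_le t w
    have hw' : distInt w ≤ |w| := by
      have := Vinogradov.distInt_le_abs_sub_int w 0
      simpa using this
    linarith
  have hM : 0 < max (distInt t) κ := lt_of_lt_of_le hκ (le_max_right _ _)
  have hM' : 0 < max (distInt (t - w)) κ := lt_of_lt_of_le hκ (le_max_right _ _)
  have h2 : max (distInt (t - w)) κ ≤ 2 * max (distInt t) κ := by
    refine max_le ?_ ?_
    · calc distInt (t - w) ≤ distInt t + κ := h1
        _ ≤ max (distInt t) κ + max (distInt t) κ := add_le_add (le_max_left _ _) (le_max_right _ _)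
        _ = 2 * max (distInt t) κ := by ring
    · linarith [le_max_right (distInt t) κ]
  rw [div_div]
  exact div_le_div_of_nonneg_left hκ.le hM' (by linarith [h2])

/-- **The truncated sawtooth series with the majorant**: for `κ = 2/(3π(2V+1))`,
`|ψ(x) − ψ_V(x)| ≤ (3/2) G_κ(x)` (`≤ 3/2` always, and `≤ 1/((2V+1)π‖x‖) = (3/2)κ/‖x‖`).
[cite: HeathBrown2001LargestPrimeFactorCubic, §3 (3.4)] [cite: Titchmarsh1986, §4.7] -/
theorem abs_saw_sub_sawPartial_le_tentG (V : ℕ) (x : ℝ) :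
    |saw x - sawPartial V x| ≤ 3 / 2 * tentG (2 / (3 * π * (2 * V + 1))) x := by
  set κ : ℝ := 2 / (3 * π * (2 * V + 1)) with hκ
  have hκ0 : 0 < κ := by rw [hκ]; positivity
  by_cases hsmall : distInt x ≤ κ
  · have hG : tentG κ x = 1 := by
      unfold tentG; rw [max_eq_right hsmall, div_self hκ0.ne']
    rw [hG, mul_one]
    exact abs_saw_sub_sawPartial_le_three_halves V x
  · push Not at hsmall
    have hd0 : 0 < distInt x := hκ0.trans hsmall
    have hfr : Int.fract x ≠ 0 := by
      intro h0
      have : distInt x = 0 := by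
        rw [distInt_eq_zero_iff]
        refine ⟨⌊x⌋, ?_⟩
        have := Int.fract_add_floor x
        linarith
      linarith
    have h := abs_saw_sub_sawPartial_le V hfr
    rw [← distInt_eq_min_fract] at h
    have hG : tentG κ x = κ / distInt x := by
      unfold tentG; rw [max_eq_left hsmall.le]
    rw [hG]
    refine h.trans (le_of_eq ?_)
    rw [hκ]
    field_simp

/-! ### `∫_0^1 G ≤ 2κ(1 + log(1/(2κ)))` -/

/-- Auxiliary fact `intervalIntegrable_tentG` for this file's estimates. [folklore] -/
theorem intervalIntegrable_tentG (hκ : 0 < κ) (a b : ℝ) : IntervalIntegrable (tentG κ) volume a b :=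
  (continuous_tentG hκ).intervalIntegrable _ _

/-- `∫_0^{1/2} G ≤ κ + κ log(1/(2κ))` for `0 < κ ≤ 1/2`. [folklore] -/
theorem integral_tentG_half_le (hκ : 0 < κ) (hκ2 : κ ≤ 1 / 2) :
    ∫ u in (0 : ℝ)..(1 / 2), tentG κ u ≤ κ + κ * Real.log (1 / (2 * κ)) := by
  rw [← integral_add_adjacent_intervals (b := κ) (intervalIntegrable_tentG hκ _ _)
    (intervalIntegrable_tentG hκ _ _)]
  have h1 : ∫ u in (0 : ℝ)..κ, tentG κ u ≤ κ := by
    have hc : ∫ _u in (0 : ℝ)..κ, (1 : ℝ) = κ := by simp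
    calc ∫ u in (0 : ℝ)..κ, tentG κ u ≤ ∫ _u in (0 : ℝ)..κ, (1 : ℝ) :=
          integral_mono_on hκ.le (intervalIntegrable_tentG hκ _ _) _root_.intervalIntegrable_const
            (fun u _ => tentG_le_one hκ u)
      _ = κ := hc
  have h2 : ∫ u in κ..(1 / 2), tentG κ u ≤ κ * Real.log (1 / (2 * κ)) := by
    calc ∫ u in κ..(1 / 2), tentG κ u ≤ ∫ u in κ..(1 / 2), κ * u⁻¹ := by
          refine integral_mono_on hκ2 (intervalIntegrable_tentG hκ _ _) ?_ (fun u hu => ?_)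
          · refine (continuousOn_const.mul (continuousOn_inv₀.mono ?_)).intervalIntegrable_of_Icc hκ2
            intro u hu; exact (hκ.trans_le hu.1).ne'
          · rw [← div_eq_mul_inv]; exact tentG_le_div hκ (hκ.trans_le hu.1) hu.2
      _ = κ * Real.log (1 / (2 * κ)) := by
          rw [intervalIntegral.integral_const_mul, integral_inv (by
            rw [Set.uIcc_of_le hκ2]; intro h; exact hκ.not_ge h.1), div_div]
  linarith

/-- **`∫_0^1 G ≤ 2κ(1 + log(1/(2κ)))`** for `0 < κ ≤ 1/2` (`G(1 − u) = G(u)`). [folklore] -/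
theorem integral_tentG_le (hκ : 0 < κ) (hκ2 : κ ≤ 1 / 2) :
    ∫ u in (0 : ℝ)..1, tentG κ u ≤ 2 * κ * (1 + Real.log (1 / (2 * κ))) := by
  rw [← integral_add_adjacent_intervals (b := 1 / 2) (intervalIntegrable_tentG hκ _ _)
    (intervalIntegrable_tentG hκ _ _)]
  have hsymm : ∫ u in (1 / 2 : ℝ)..1, tentG κ u = ∫ u in (0 : ℝ)..(1 / 2), tentG κ u := by
    have h := intervalIntegral.integral_comp_sub_left (fun u => tentG κ u) (1 : ℝ) (a := 0) (b := 1 / 2)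
    simp only [tentG_one_sub] at h
    rw [h]; norm_num
  rw [hsymm]
  have := integral_tentG_half_le hκ hκ2
  linarith

/-! ### `G ≤ 4 (G ∗ K_H)` -/

/-- The smoothing `(G ∗ K_H)(t) = ∫_0^1 G(u) K_H(t − u) du`. [folklore] -/
def convG (κ : ℝ) (H : ℕ) (t : ℝ) : ℝ := ∫ u in (0 : ℝ)..1, tentG κ u * fejerKernel H (t - u)

/-- **`G(t) ≤ 4 (G ∗ K_H)(t)`** when `1/(H+1) ≤ κ ≤ 1/2`: substitute `u = t − w`, use periodicity to
integrate over `w ∈ [−1/2, 1/2]`, restrict to `|w| ≤ 1/(H+1)` where `G(t − w) ≥ G(t)/2`, and use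
that `K_H` has mass `≥ 1/2` there. [folklore] -/
theorem tentG_le_four_mul_conv (hκ : 0 < κ) (hκ2 : κ ≤ 1 / 2) {H : ℕ} (hH : 1 / ((H : ℝ) + 1) ≤ κ)
    (t : ℝ) : tentG κ t ≤ 4 * convG κ H t := by
  set η : ℝ := 1 / ((H : ℝ) + 1) with hη
  have hη0 : 0 < η := by rw [hη]; positivity
  have hη2 : η ≤ 1 / 2 := hH.trans hκ2
  -- the integrand as a function of `w = t − u`
  set F : ℝ → ℝ := fun w => tentG κ (t - w) * fejerKernel H w with hF
  have hFcont : Continuous F :=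
    ((continuous_tentG hκ).comp (continuous_const.sub continuous_id)).mul (continuous_fejerKernel H)
  have hFper : Function.Periodic F 1 := by
    intro w
    simp only [hF]
    rw [fejerKernel_periodic H w, show t - (w + 1) = t - w - 1 by ring]
    have := tentG_periodic κ (t - w - 1)
    rw [show t - w - 1 + 1 = t - w by ring] at this
    rw [← this]
  have hF0 : ∀ w, 0 ≤ F w := fun w => mul_nonneg (tentG_nonneg hκ _) (fejerKernel_nonneg H _)
  -- `convG = ∫_{t-1}^{t} F = ∫_{-1/2}^{1/2} F`
  have hconv : convG κ H t = ∫ w in (-(1 / 2) : ℝ)..(-(1 / 2) + 1), F w := by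
    unfold convG
    have h1 : (∫ u in (0 : ℝ)..1, tentG κ u * fejerKernel H (t - u)) = ∫ u in (0 : ℝ)..1, F (t - u) := by
      refine integral_congr (fun u _ => ?_)
      simp only [hF, sub_sub_cancel]
    rw [h1, intervalIntegral.integral_comp_sub_left (fun w => F w) t, sub_zero,
      show t - 1 = (t - 1) by rfl]
    rw [show t = (t - 1) + 1 by ring]
    simp only [add_sub_cancel_right]
    exact (hFper.intervalIntegral_add_eq (t - 1) (-(1 / 2)))
  -- restrict to `[-η, η]`
  have hsub : ∫ w in (-η)..η, F w ≤ ∫ w in (-(1 / 2) : ℝ)..(-(1 / 2) + 1), F w := by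
    refine integral_mono_interval (by linarith) (by linarith) (by linarith) ?_
      (hFcont.intervalIntegrable _ _)
    exact Filter.Eventually.of_forall hF0
  -- on `[-η, η]`, `F w ≥ (G(t)/2) K_H(w)`
  have hlow : ∫ w in (-η)..η, tentG κ t / 2 * fejerKernel H w ≤ ∫ w in (-η)..η, F w := by
    refine integral_mono_on (by linarith) ((continuous_const.mul (continuous_fejerKernel H)).intervalIntegrable _ _)
      (hFcont.intervalIntegrable _ _) (fun w hw => ?_)
    simp only [hF]
    refine mul_le_mul_of_nonneg_right (tentG_sub_ge hκ t ?_) (fejerKernel_nonneg H w)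
    exact (abs_le.2 ⟨by linarith [hw.1], hw.2⟩).trans hH
  have hmass := le_integral_fejerKernel_near_zero H hη0 hη2
  have hmass' : 1 / 2 ≤ ∫ w in (-η)..η, fejerKernel H w := by
    have : 1 - 1 / (2 * ((H : ℝ) + 1) * η) = 1 / 2 := by
      rw [hη]; field_simp; ring
    linarith [this ▸ hmass]
  rw [intervalIntegral.integral_const_mul] at hlow
  have hG0 := tentG_nonneg hκ t
  calc tentG κ t = 4 * (tentG κ t / 2 * (1 / 2)) := by ring
    _ ≤ 4 * (tentG κ t / 2 * ∫ w in (-η)..η, fejerKernel H w) := by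
        gcongr
    _ ≤ 4 * convG κ H t := by
        rw [hconv]
        exact mul_le_mul_of_nonneg_left (hlow.trans hsub) (by norm_num)

/-! ### `∑_j K_H(x_j − u) ≤ ∑_{|d| ≤ H} |S(d)|` -/

/-- **The Fejér kernel summed over the points**: for every `u`,
`∑_j K_H(x_j − u) ≤ ∑_{d=−H}^{H} |∑_j e(d x_j)|` (`K_H` is a trigonometric polynomial of degree `H`
with coefficients in `[0, 1]`). [folklore] -/
theorem sum_fejerKernel_sub_le {ι : Type*} (s : Finset ι) (x : ι → ℝ) (H : ℕ) (u : ℝ) :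
    ∑ j ∈ s, fejerKernel H (x j - u) ≤
      ∑ d ∈ Icc (-(H : ℤ)) H, ‖∑ j ∈ s, (𝐞 ((d : ℝ) * x j) : ℂ)‖ := by
  classical
  set P := Ioc 0 (H + 1) with hP
  set T : ℝ := ∑ d ∈ Icc (-(H : ℤ)) H, ‖∑ j ∈ s, (𝐞 ((d : ℝ) * x j) : ℂ)‖ with hT
  have hH : ((H : ℂ) + 1) ≠ 0 := by exact_mod_cast Nat.succ_ne_zero H
  have hHr : (0 : ℝ) < H + 1 := by positivity
  -- complex form
  have hsum : ((∑ j ∈ s, fejerKernel H (x j - u) : ℝ) : ℂ) =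
      ((H : ℂ) + 1)⁻¹ * ∑ n ∈ P, ∑ n' ∈ P,
        (𝐞 (-(((n : ℝ) - n') * u)) : ℂ) * ∑ j ∈ s, (𝐞 (((n : ℝ) - n') * x j) : ℂ) := by
    push_cast
    simp_rw [fejerKernel_eq_sum]
    rw [← Finset.mul_sum]
    congr 1
    rw [Finset.sum_comm]
    refine Finset.sum_congr rfl fun n _ => ?_
    rw [Finset.sum_comm]
    refine Finset.sum_congr rfl fun n' _ => ?_
    rw [Finset.mul_sum]
    refine Finset.sum_congr rfl fun j _ => ?_
    rw [← Circle.coe_mul, ← AddChar.map_add_eq_mul]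
    congr 2
    ring
  have hreal : ∑ j ∈ s, fejerKernel H (x j - u) =
      (((H : ℂ) + 1)⁻¹ * ∑ n ∈ P, ∑ n' ∈ P,
        (𝐞 (-(((n : ℝ) - n') * u)) : ℂ) * ∑ j ∈ s, (𝐞 (((n : ℝ) - n') * x j) : ℂ)).re := by
    rw [← hsum, Complex.ofReal_re]
  rw [hreal]
  refine (Complex.re_le_norm _).trans ?_
  rw [norm_mul, norm_inv, show ‖((H : ℂ) + 1)‖ = (H : ℝ) + 1 by
    rw [show ((H : ℂ) + 1) = ((H + 1 : ℕ) : ℂ) by push_cast; ring, Complex.norm_natCast]; push_cast; ring]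
  rw [inv_mul_le_iff₀ hHr]
  -- each inner sum over `n'` is at most `T`
  have hinner : ∀ n ∈ P, ‖∑ n' ∈ P,
      (𝐞 (-(((n : ℝ) - n') * u)) : ℂ) * ∑ j ∈ s, (𝐞 (((n : ℝ) - n') * x j) : ℂ)‖ ≤ T := by
    intro n hn
    refine (norm_sum_le _ _).trans ?_
    have hterm : ∀ n' ∈ P, ‖(𝐞 (-(((n : ℝ) - n') * u)) : ℂ) * ∑ j ∈ s, (𝐞 (((n : ℝ) - n') * x j) : ℂ)‖
        = ‖∑ j ∈ s, (𝐞 ((((n : ℤ) - n' : ℤ) : ℝ) * x j) : ℂ)‖ := by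
      intro n' _
      rw [norm_mul, Vinogradov.norm_fourierChar, one_mul]
      push_cast; rfl
    rw [Finset.sum_congr rfl hterm]
    -- reindex by `d = n − n'`
    have hinj : Set.InjOn (fun n' : ℕ => (n : ℤ) - n') ↑P := by
      intro a _ b _ h; simp only at h; omega
    rw [← Finset.sum_image (f := fun d : ℤ => ‖∑ j ∈ s, (𝐞 ((d : ℝ) * x j) : ℂ)‖) hinj]
    refine Finset.sum_le_sum_of_subset_of_nonneg (fun d hd => ?_) (fun _ _ _ => norm_nonneg _)
    rw [Finset.mem_image] at hd
    obtain ⟨n', hn', rfl⟩ := hd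
    rw [hP, Finset.mem_Ioc] at hn hn'
    rw [Finset.mem_Icc]
    constructor <;> omega
  calc ‖∑ n ∈ P, ∑ n' ∈ P, (𝐞 (-(((n : ℝ) - n') * u)) : ℂ) * ∑ j ∈ s, (𝐞 (((n : ℝ) - n') * x j) : ℂ)‖
      ≤ ∑ n ∈ P, ‖∑ n' ∈ P, (𝐞 (-(((n : ℝ) - n') * u)) : ℂ) * ∑ j ∈ s, (𝐞 (((n : ℝ) - n') * x j) : ℂ)‖ :=
        norm_sum_le _ _
    _ ≤ ∑ _n ∈ P, T := Finset.sum_le_sum hinner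
    _ = (H + 1) * T := by
        rw [Finset.sum_const, hP, Nat.card_Ioc, tsub_zero, nsmul_eq_mul]; push_cast; ring

/-- **The smoothed majorant summed over the points**:
`∑_j (G ∗ K_H)(x_j) ≤ (∫_0^1 G) ∑_{|d| ≤ H} |S(d)|`. [folklore] -/
theorem sum_convG_le {ι : Type*} (s : Finset ι) (x : ι → ℝ) (hκ : 0 < κ) (H : ℕ) :
    ∑ j ∈ s, convG κ H (x j) ≤
      (∫ u in (0 : ℝ)..1, tentG κ u) * ∑ d ∈ Icc (-(H : ℤ)) H, ‖∑ j ∈ s, (𝐞 ((d : ℝ) * x j) : ℂ)‖ := by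
  have hint : ∀ j ∈ s, IntervalIntegrable (fun u => tentG κ u * fejerKernel H (x j - u)) volume 0 1 :=
    fun j _ => ((continuous_tentG hκ).mul ((continuous_fejerKernel H).comp
      (continuous_const.sub continuous_id))).intervalIntegrable _ _
  unfold convG
  rw [← intervalIntegral.integral_finsetSum hint]
  have e : ∀ u, ∑ j ∈ s, tentG κ u * fejerKernel H (x j - u) = tentG κ u * ∑ j ∈ s, fejerKernel H (x j - u) :=
    fun u => by rw [Finset.mul_sum]
  simp_rw [e]
  rw [← intervalIntegral.integral_mul_const]
  have hint2 : IntervalIntegrable (fun u => tentG κ u * ∑ j ∈ s, fejerKernel H (x j - u)) volume 0 1 :=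
    ((continuous_tentG hκ).mul (continuous_finsetSum _ (fun j _ =>
      (continuous_fejerKernel H).comp (continuous_const.sub continuous_id)))).intervalIntegrable _ _
  refine integral_mono_on zero_le_one hint2 ((intervalIntegrable_tentG hκ _ _).mul_const _)
    (fun u _ => ?_)
  exact mul_le_mul_of_nonneg_left (sum_fejerKernel_sub_le s x H u) (tentG_nonneg hκ u)

/-! ### The main estimate -/

/-- The truncated series summed: `|∑_j ψ_V(x_j)| ≤ (1/π) ∑_{ν=1}^{V} |S(ν)|/ν`
(`sin(2πνx) = Im e(νx)`). [cite: HeathBrown2001LargestPrimeFactorCubic, §3 (3.4)] -/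
theorem abs_sum_sawPartial_le {ι : Type*} (s : Finset ι) (x : ι → ℝ) (V : ℕ) :
    |∑ j ∈ s, sawPartial V (x j)| ≤
      (1 / π) * ∑ ν ∈ Icc 1 V, ‖∑ j ∈ s, (𝐞 ((ν : ℝ) * x j) : ℂ)‖ / ν := by
  have hsin : ∀ (ν : ℕ) (y : ℝ), Real.sin (2 * π * ν * y) = ((𝐞 ((ν : ℝ) * y) : ℂ)).im := by
    intro ν y
    rw [Real.fourierChar_apply, Complex.exp_ofReal_mul_I_im]
    congr 1; ring
  have e1 : ∑ j ∈ s, sawPartial V (x j) =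
      -∑ ν ∈ Icc 1 V, (∑ j ∈ s, (𝐞 ((ν : ℝ) * x j) : ℂ)).im / (π * ν) := by
    simp only [Literature.NumberTheory.LFunctions.AFE.sawPartial_def, hsin]
    rw [Finset.sum_neg_distrib, Finset.sum_comm]
    congr 1
    refine Finset.sum_congr rfl (fun ν _ => ?_)
    rw [Complex.im_sum, Finset.sum_div]
  rw [e1, abs_neg, Finset.mul_sum]
  refine (Finset.abs_sum_le_sum_abs _ _).trans (Finset.sum_le_sum (fun ν hν => ?_))
  rw [Finset.mem_Icc] at hν
  have hν0 : (0 : ℝ) < ν := by exact_mod_cast hν.1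
  rw [abs_div, abs_of_pos (by positivity : (0 : ℝ) < π * ν)]
  rw [show 1 / π * (‖∑ j ∈ s, (𝐞 ((ν : ℝ) * x j) : ℂ)‖ / ν) = ‖∑ j ∈ s, (𝐞 ((ν : ℝ) * x j) : ℂ)‖ / (π * ν)
    by field_simp]
  exact div_le_div_of_nonneg_right (Complex.abs_im_le_norm _) (by positivity)

/-- **Sums of the sawtooth over a point set** (Heath-Brown's (3.4) step, pp. 566–567): for any
finite family of reals `x_j`, `V ≥ 1`, `H = 5(2V+1)` and `S(d) = ∑_j e(d x_j)`,
`|∑_j ψ(x_j)| ≤ (1/π) ∑_{ν=1}^{V} |S(ν)|/ν + (3(2 + log(2V+1))/(2V+1)) ∑_{d=−H}^{H} |S(d)|`.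
[cite: HeathBrown2001LargestPrimeFactorCubic, §3 (3.4) and (2.9)] -/
theorem abs_sum_saw_le {ι : Type*} (s : Finset ι) (x : ι → ℝ) {V : ℕ} (hV : 1 ≤ V) :
    |∑ j ∈ s, saw (x j)| ≤
      (1 / π) * ∑ ν ∈ Icc 1 V, ‖∑ j ∈ s, (𝐞 ((ν : ℝ) * x j) : ℂ)‖ / ν +
        3 * (2 + Real.log (2 * V + 1)) / (2 * V + 1) *
          ∑ d ∈ Icc (-((5 * (2 * V + 1) : ℕ) : ℤ)) (5 * (2 * V + 1) : ℕ),
            ‖∑ j ∈ s, (𝐞 ((d : ℝ) * x j) : ℂ)‖ := by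
  set κ : ℝ := 2 / (3 * π * (2 * V + 1)) with hκ
  set H : ℕ := 5 * (2 * V + 1) with hH
  set T : ℝ := ∑ d ∈ Icc (-(H : ℤ)) H, ‖∑ j ∈ s, (𝐞 ((d : ℝ) * x j) : ℂ)‖ with hT
  have hV1 : (1 : ℝ) ≤ V := by exact_mod_cast hV
  have hπ3 : (3 : ℝ) < π := Real.pi_gt_three
  have hπ4 : π < 3.15 := Real.pi_lt_d2
  have hκ0 : 0 < κ := by rw [hκ]; positivity
  have h2V : (3 : ℝ) ≤ 2 * V + 1 := by linarith
  have hκ2 : κ ≤ 1 / 2 := by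
    rw [hκ, div_le_iff₀ (by positivity)]; nlinarith
  have hHκ : 1 / ((H : ℝ) + 1) ≤ κ := by
    rw [hH, hκ]; push_cast
    rw [div_le_div_iff₀ (by positivity) (by positivity)]; nlinarith
  have hT0 : 0 ≤ T := Finset.sum_nonneg (fun _ _ => norm_nonneg _)
  -- split `ψ = ψ_V + (ψ − ψ_V)`
  have hsplit : ∑ j ∈ s, saw (x j) = ∑ j ∈ s, sawPartial V (x j) + ∑ j ∈ s, (saw (x j) - sawPartial V (x j)) := by
    rw [← Finset.sum_add_distrib]; simp
  rw [hsplit]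
  refine (abs_add_le _ _).trans (add_le_add (abs_sum_sawPartial_le s x V) ?_)
  -- the error terms
  have herr : |∑ j ∈ s, (saw (x j) - sawPartial V (x j))| ≤ 3 / 2 * ∑ j ∈ s, tentG κ (x j) := by
    refine (Finset.abs_sum_le_sum_abs _ _).trans ?_
    rw [Finset.mul_sum]
    exact Finset.sum_le_sum (fun j _ => abs_saw_sub_sawPartial_le_tentG V (x j))
  have hG : ∑ j ∈ s, tentG κ (x j) ≤ 4 * ((∫ u in (0 : ℝ)..1, tentG κ u) * T) := by
    calc ∑ j ∈ s, tentG κ (x j) ≤ ∑ j ∈ s, 4 * convG κ H (x j) :=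
          Finset.sum_le_sum (fun j _ => tentG_le_four_mul_conv hκ0 hκ2 hHκ (x j))
      _ = 4 * ∑ j ∈ s, convG κ H (x j) := by rw [Finset.mul_sum]
      _ ≤ 4 * ((∫ u in (0 : ℝ)..1, tentG κ u) * T) :=
          mul_le_mul_of_nonneg_left (sum_convG_le s x hκ0 H) (by norm_num)
  have hI := integral_tentG_le hκ0 hκ2
  -- numerics: `6 · 2κ(1 + log(1/(2κ))) ≤ 3(2 + log(2V+1))/(2V+1)`
  have hlog : Real.log (1 / (2 * κ)) ≤ 1 + Real.log (2 * V + 1) := by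
    have e : 1 / (2 * κ) = (3 * π / 4) * (2 * V + 1) := by rw [hκ]; field_simp; ring
    rw [e, Real.log_mul (by positivity) (by positivity)]
    have : Real.log (3 * π / 4) ≤ 1 := by
      rw [Real.log_le_iff_le_exp (by positivity)]
      have := Real.exp_one_gt_d9
      nlinarith
    linarith
  have hlog0 : 0 ≤ Real.log (2 * V + 1) := Real.log_nonneg (by linarith)
  have hκ' : 12 * κ ≤ 3 / (2 * V + 1) := by
    have e : 12 * κ = 8 / (π * (2 * V + 1)) := by rw [hκ]; field_simp; ring
    rw [e, div_le_div_iff₀ (by positivity) (by positivity)]; nlinarith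
  calc |∑ j ∈ s, (saw (x j) - sawPartial V (x j))|
      ≤ 3 / 2 * (4 * ((∫ u in (0 : ℝ)..1, tentG κ u) * T)) := herr.trans (by gcongr)
    _ = 6 * (∫ u in (0 : ℝ)..1, tentG κ u) * T := by ring
    _ ≤ 6 * (2 * κ * (1 + Real.log (1 / (2 * κ)))) * T := by gcongr
    _ ≤ 6 * (2 * κ * (2 + Real.log (2 * V + 1))) * T := by
        apply mul_le_mul_of_nonneg_right _ hT0
        apply mul_le_mul_of_nonneg_left _ (by norm_num)
        exact mul_le_mul_of_nonneg_left (by linarith) (by positivity)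
    _ = 12 * κ * (2 + Real.log (2 * V + 1)) * T := by ring
    _ ≤ 3 / (2 * V + 1) * (2 + Real.log (2 * V + 1)) * T := by
        gcongr
    _ = 3 * (2 + Real.log (2 * V + 1)) / (2 * V + 1) * T := by ring

end Literature.NumberTheory.Sieve.LargestPrimeFactorCubic
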